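import Mathlib
import Summits.Ventures.DiscreteObjects.Mahler.FourTermMeasureBound
import Summits.Ventures.DiscreteObjects.Mahler.DobrowolskiLemma

/-!
# `M(P) ≥ |m| / L(G)` when `P ≡ G (mod m)`: the reduction of a small-measure polynomial is not short
(venture `DiscreteObjects`, target L)

Cell `pub-namedobj`, seat `pub-namedobj-mahler-g24`. Framing: lottery ticket; floor = certified
bounds/negative ranges.

The Borwein–Dobrowolski–Mossinghoff resultant step (`FourTermMeasureBound`) with an ARBITRARY monic
auxiliary polynomial `G` of the same degree: if `P ∈ ℤ[X]` is monic irreducible of degree `n`, `G ≠ P` is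
monic of degree `n` and `P ≡ G (mod m)` coefficientwise, then `Res(P, G) = mⁿ Res(P, (G - P)/m) ≠ 0` and
`|G(α)| ≤ L(G) max(1,|α|)ⁿ` (`L(G) = Σ|g_i|`, `DobrowolskiLemma.norm_eval_le_length_mul`), so

* `abs_le_length_mul_measure_of_congr` — **`|m| ≤ L(G) · M(P)`**;
* `abs_lt_of_congr_of_subLehmer` — for a monic irreducible SUB-LEHMER `P`: `|m| < 1.17629 · L(G)`, i.e.
  **the reduction of a Lehmer-ticket core modulo `m` admits no monic lift of length `≤ 0.85 |m|`**
  (`m = 4`: `P ≢ xⁿ ± x^j ± 1`; `m = 5`: no lift of length `≤ 4`; …) — a family of congruence sieves for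
  the census, containing `EvenMiddleCoefficients` (`G = xⁿ ± 1`, `L = 2`) and [BDM07]'s class `D_m`
  (there `(x - 1)G = x^{n+1} - 1` is used instead).

Method of [BDM07, Lemma 3.1 / Thm 3.3] (cyclotomic `G`) and [Dobrowolski2006, §5–6] (`G = xⁿ + η` for
quadrinomials); the statement for arbitrary monic `G` is an elementary consequence, not found verbatim in print —
PROVISIONAL wording.
-/

namespace Summit.Ventures.DiscreteObjects.Mahler

open Polynomial

/-- If no complex root of `f ≠ 0` is a root of `G` (`deg G ≤ N`), then `Res_{(deg f, N)}(f, G) ≠ 0`. -/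
theorem resultant_ne_zero_of_forall_root {f G : ℤ[X]} {N : ℕ} (hf : f ≠ 0) (hG : G.natDegree ≤ N)
    (h : ∀ α : ℂ, aeval α f = 0 → (G.map (Int.castRingHom ℂ)).eval α ≠ 0) :
    f.resultant G f.natDegree N ≠ 0 := by
  intro h0
  have hinj : Function.Injective (Int.castRingHom ℂ) := (Int.castRingHom ℂ).injective_int
  have hC := resultant_intCast_eq (f := f) hG
  rw [h0, Int.cast_zero] at hC
  have hlc : (f.map (Int.castRingHom ℂ)).leadingCoeff ≠ 0 := by
    rw [Ne, leadingCoeff_eq_zero, Polynomial.map_eq_zero_iff hinj]; exact hf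
  rcases mul_eq_zero.mp hC.symm with h1 | h2
  · exact hlc (pow_eq_zero_iff'.mp h1).1
  · rw [Multiset.prod_eq_zero_iff, Multiset.mem_map] at h2
    obtain ⟨α, hαmem, hα0⟩ := h2
    exact h α (aeval_eq_zero_of_mem_roots_map hαmem) hα0

/-- For a monic irreducible `P ∈ ℤ[X]` and a complex root `α`, every integer polynomial vanishing at `α`
is `0` or has degree `≥ deg P`. -/
theorem natDegree_le_of_aeval_eq_zero_of_irreducible {P T : ℤ[X]} (hirr : Irreducible P) (hmon : P.Monic)
    {α : ℂ} (hα : aeval α P = 0) (hT : aeval α T = 0) (hT0 : T ≠ 0) : P.natDegree ≤ T.natDegree := by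
  have hint : IsIntegral ℤ α := ⟨P, hmon, by rwa [← aeval_def]⟩
  have hdvd : minpoly ℤ α ∣ P := minpoly.isIntegrallyClosed_dvd hint hα
  obtain ⟨c, hc⟩ := hdvd
  have hcu : IsUnit c := by
    rcases hirr.isUnit_or_isUnit hc with h | h
    · exact absurd h (minpoly.not_isUnit ℤ α)
    · exact h
  have hdegP : P.natDegree = (minpoly ℤ α).natDegree := by
    rw [hc, natDegree_mul (minpoly.ne_zero hint) hcu.ne_zero, natDegree_eq_zero_of_isUnit hcu, add_zero]
  have h := minpoly.IsIntegrallyClosed.degree_le_of_ne_zero (R := ℤ) hT0 hT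
  rw [degree_eq_natDegree (minpoly.ne_zero hint), degree_eq_natDegree hT0] at h
  rw [hdegP]; exact_mod_cast h

/-- **`|m| ≤ L(G) · M(P)`**: if `P ∈ ℤ[X]` is monic irreducible of degree `n ≥ 1`, `G ∈ ℤ[X]` is monic
of degree `n` with `G ≠ P`, and `P ≡ G (mod m)` (i.e. `C m ∣ P - G`), then `|m| ≤ L(G) M(P)` with
`L(G) = Σ_i |g_i|`. -/
theorem abs_le_length_mul_measure_of_congr {P G : ℤ[X]} {m : ℤ} (hirr : Irreducible P) (hmon : P.Monic)
    (hdeg : 0 < P.natDegree) (hGm : G.Monic) (hGdeg : G.natDegree = P.natDegree) (hGP : G ≠ P)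
    (hcong : C m ∣ P - G) :
    (|m| : ℝ) ≤ (∑ i ∈ Finset.range (G.natDegree + 1), (|G.coeff i| : ℝ)) * intMahlerMeasure P := by
  set n := P.natDegree with hn
  have hP0 : P ≠ 0 := hmon.ne_zero
  obtain ⟨T, hT⟩ := hcong
  by_cases hm0 : m = 0
  · rw [hm0]; simp only [abs_zero, Int.cast_zero]
    exact mul_nonneg (Finset.sum_nonneg fun i _ => abs_nonneg _) (by linarith [one_le_intMahlerMeasure hP0])
  -- `G = C m * (-T) + P * 1`
  have hG : G = C m * (-T) + P * 1 := by rw [mul_neg, ← hT]; ring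
  -- `T ≠ 0`, `deg T < n`
  have hT0 : T ≠ 0 := by
    intro h; rw [h, mul_zero, sub_eq_zero] at hT; exact hGP hT.symm
  have hTdeg : T.natDegree < n := by
    have h1 : (C m * T).natDegree = T.natDegree := natDegree_C_mul hm0
    have h2 : (P - G).degree < P.degree := by
      refine degree_sub_lt ?_ hP0 ?_
      · rw [degree_eq_natDegree hP0, degree_eq_natDegree hGm.ne_zero, hGdeg]
      · rw [hmon.leadingCoeff, hGm.leadingCoeff]
    have h3 : (P - G).natDegree < n := by
      have hPG0 : P - G ≠ 0 := by rw [hT]; exact mul_ne_zero (by simp [hm0]) hT0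
      rw [degree_eq_natDegree hPG0, degree_eq_natDegree hP0] at h2
      exact_mod_cast h2
    rw [← h1, ← hT]; exact h3
  -- `Res(P, G) ≠ 0`: a common root `α` would be a root of `T`
  have hne : P.resultant G P.natDegree n ≠ 0 := by
    refine resultant_ne_zero_of_forall_root hP0 (by rw [hGdeg]) ?_
    intro α hα hGα
    have hTα : aeval α T = 0 := by
      have hGα' : aeval α G = 0 := by rwa [eval_map, ← algebraMap_int_eq, ← aeval_def] at hGα
      have h1 : aeval α (P - G) = 0 := by rw [map_sub, hα, hGα', sub_zero]
      rw [hT, map_mul, aeval_C, algebraMap_int_eq, eq_intCast] at h1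
      rcases mul_eq_zero.mp h1 with h | h
      · exact absurd (by exact_mod_cast h : m = 0) hm0
      · exact h
    have := natDegree_le_of_aeval_eq_zero_of_irreducible hirr hmon hα hTα hT0
    omega
  have hroot : ∀ α : ℂ, ‖(G.map (Int.castRingHom ℂ)).eval α‖ ≤
      (∑ i ∈ Finset.range (G.natDegree + 1), (|G.coeff i| : ℝ)) * max 1 ‖α‖ ^ n := by
    intro α; rw [← hGdeg]; exact norm_eval_le_length_mul G α
  have h := abs_pow_le_pow_mul_measure_pow_of_resultant (N := n)
    (K := ∑ i ∈ Finset.range (G.natDegree + 1), (|G.coeff i| : ℝ)) hG (by rw [natDegree_one]; omega)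
    (by rw [hGdeg]) hne hroot
  rw [← hn, ← mul_pow] at h
  have hK0 : 0 ≤ (∑ i ∈ Finset.range (G.natDegree + 1), (|G.coeff i| : ℝ)) * intMahlerMeasure P :=
    mul_nonneg (Finset.sum_nonneg fun i _ => abs_nonneg _) (by linarith [one_le_intMahlerMeasure hP0])
  exact le_of_pow_le_pow_left₀ (by omega) hK0 h

/-- **Congruence sieve for the Lehmer ticket.**  A monic irreducible sub-Lehmer `P` of degree `n` is not
congruent modulo `m` to any monic `G ≠ P` of degree `n` with `1.17629 · L(G) ≤ |m|`; stated as
`|m| < 1.17629 · L(G)` whenever `C m ∣ P - G`. -/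
theorem abs_lt_of_congr_of_subLehmer {P G : ℤ[X]} {m : ℤ} (hirr : Irreducible P) (hmon : P.Monic)
    (hP : SubLehmer P) (hGm : G.Monic) (hGdeg : G.natDegree = P.natDegree) (hGP : G ≠ P)
    (hcong : C m ∣ P - G) :
    (|m| : ℝ) < 117629 / 100000 * ∑ i ∈ Finset.range (G.natDegree + 1), (|G.coeff i| : ℝ) := by
  have hL := lehmer_measure_upper_bound
  obtain ⟨h1, h2⟩ := hP
  have hdeg : 0 < P.natDegree := by
    by_contra hd
    have hd0 : P.natDegree = 0 := by omega
    have hc : P.coeff 0 = 1 := by have := hmon.coeff_natDegree; rwa [hd0] at this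
    have h3 := h1
    rw [eq_C_of_natDegree_eq_zero hd0, intMahlerMeasure_C, hc] at h3
    norm_num at h3
  have h := abs_le_length_mul_measure_of_congr hirr hmon hdeg hGm hGdeg hGP hcong
  have hLpos : (1 : ℝ) ≤ ∑ i ∈ Finset.range (G.natDegree + 1), (|G.coeff i| : ℝ) := one_le_length hGm.ne_zero
  have hM : intMahlerMeasure P < 117629 / 100000 := lt_trans h2 hL
  nlinarith

end Summit.Ventures.DiscreteObjects.Mahler
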